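import Literature.MathematicalPhysics.QuantumManyBody.SwapPurity
import Literature.MathematicalPhysics.QuantumManyBody.LiebYngvasonBoxBound
import Mathlib.MeasureTheory.Integral.Lebesgue.DominatedConvergence
import HarnessLib

/-!
# Route BECCutLineWeakDisorder — `WitnessTransfer`, I: the landscape ratio functional

Support file (does not close the item) for item stmt-AtomisticToContinuum-14978
(`Summit.AtomisticToContinuum.BoseEinsteinCondensation.Theses.BECCutLineWeakDisorder.WitnessTransfer`,
`TwoReplicaTransienceBound → LandscapeBound`). Both statements of that implication are about the
**landscape ratio**

  `R_L(f) = ∫ L³ m(Y)² / s(Y)² dY`,  `m(Y) = ∫ |f(x, Y)|² dx`, `s(Y) = ∫ |f(x, Y)| dx`,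

of a function `f` on `(ℝ³)^{n+1}` split as `x :: Y = Matrix.vecCons x Y` (Bolthausen's second
moment `E[W²]` of the cut half-line partition function, in the route's reading). This file is the
measure theory of `R_L` needed to pass it through limits (no definitions are introduced; the
functional is written out verbatim as in the route file):

* `mul_sq_div_sq_le`, `tendsto_mul_sq_div_sq`, `mul_sq_div_sq_le_liminf` — `[0, ∞]` arithmetic of
  the integrand `c · m² / s²`: bounded by `c K²` when `m ≤ K s`, continuous at points with
  `0 < s < ∞`, lower semicontinuous along `m ≤ K s`;
* `tendsto_lintegral_nnnorm_pow_slice` — dominated convergence of the slice masses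
  `∫ |g_i|^p dx → ∫ |g|^p dx` for uniformly bounded functions supported in the box `Λ_L`;
* `lintegral_ratio_le_liminf` — **Fatou for the ratio**: `R_L(lim f_k) ≤ liminf R_L(f_k)` for a
  pointwise convergent, uniformly bounded sequence supported in `Λ_L^{n+1}`;
* `tendsto_lintegral_ratio` — **dominated convergence for the ratio** given a.e. convergence of
  the integrand, and `tendsto_ratioIntegrand` — that convergence at every slice `Y` of positive
  mass `s(Y) > 0`;
* `lintegral_ratio_const_mul` (`R_L(c f) = c² R_L(f)`), `lintegral_nnnorm_slice_pos`.
-/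

noncomputable section

open MeasureTheory Filter Set
open scoped ENNReal NNReal Topology

namespace Summit.AtomisticToContinuum.BoseEinsteinCondensation.Theorems.CutLineWitness

open Literature.MathematicalPhysics.QuantumManyBody.BoseGas

/-! ### `[0, ∞]` arithmetic of the integrand `c · m² / s²` -/

/-- If `m ≤ K s` then `c m² / s² ≤ c K²` (in `[0, ∞]`, with `x / 0`, `x / ∞` conventions).
[folklore] -/
theorem mul_sq_div_sq_le {m s c K : ℝ≥0∞} (h : m ≤ K * s) : c * m ^ 2 / s ^ 2 ≤ c * K ^ 2 := by
  calc c * m ^ 2 / s ^ 2 ≤ c * (K * s) ^ 2 / s ^ 2 := by gcongr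
    _ = c * K ^ 2 * (s ^ 2 / s ^ 2) := by rw [mul_pow, ← mul_assoc, mul_div_assoc]
    _ ≤ c * K ^ 2 * 1 := by gcongr; exact ENNReal.div_self_le_one
    _ = c * K ^ 2 := mul_one _

/-- Continuity of `(m, s) ↦ c m² / s²` at a point with `m < ∞` and `0 < s < ∞`. [folklore] -/
theorem tendsto_mul_sq_div_sq {ι : Type*} {l : Filter ι} {m s : ι → ℝ≥0∞} {m₀ s₀ c : ℝ≥0∞}
    (hc : c ≠ ⊤) (hm : Tendsto m l (𝓝 m₀)) (hs : Tendsto s l (𝓝 s₀)) (hm₀ : m₀ ≠ ⊤)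
    (hs₀ : s₀ ≠ 0) (hs₀' : s₀ ≠ ⊤) :
    Tendsto (fun i => c * m i ^ 2 / s i ^ 2) l (𝓝 (c * m₀ ^ 2 / s₀ ^ 2)) := by
  have h1 : Tendsto (fun i => c * m i ^ 2) l (𝓝 (c * m₀ ^ 2)) :=
    ENNReal.Tendsto.const_mul (ENNReal.Tendsto.pow hm) (Or.inr hc)
  have h2 : Tendsto (fun i => s i ^ 2) l (𝓝 (s₀ ^ 2)) := ENNReal.Tendsto.pow hs
  have _ := hm₀
  exact ENNReal.Tendsto.div h1 (Or.inr (pow_ne_zero 2 hs₀)) h2 (Or.inl (ENNReal.pow_ne_top hs₀'))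

/-- Lower semicontinuity of `c m² / s²` along limits with `m ≤ K s` (`c, K < ∞`): the limit value
is at most the `liminf` (at `s = 0` both `m` and the value vanish; at `s = ∞` the value
vanishes). [folklore] -/
theorem mul_sq_div_sq_le_liminf {ι : Type*} {l : Filter ι} [l.NeBot] {m s : ι → ℝ≥0∞}
    {m₀ s₀ c K : ℝ≥0∞} (hc : c ≠ ⊤) (hK : K ≠ ⊤) (hm : Tendsto m l (𝓝 m₀))
    (hs : Tendsto s l (𝓝 s₀)) (hms : m₀ ≤ K * s₀) :
    c * m₀ ^ 2 / s₀ ^ 2 ≤ liminf (fun i => c * m i ^ 2 / s i ^ 2) l := by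
  rcases eq_or_ne s₀ 0 with h0 | h0
  · have hm0 : m₀ = 0 := le_zero_iff.1 (by simpa [h0] using hms)
    simp [hm0]
  rcases eq_or_ne s₀ ⊤ with ht | ht
  · simp [ht, ENNReal.div_top]
  have hm₀ : m₀ ≠ ⊤ := ne_top_of_le_ne_top (ENNReal.mul_ne_top hK ht) hms
  exact (tendsto_mul_sq_div_sq hc hm hs hm₀ h0 ht).liminf_eq.ge

/-! ### Slices `x ↦ f(x :: Y)` -/

variable {n : ℕ}

/-- `x :: Y ∈ Λ_L^{n+1}` iff `x ∈ Λ_L` and `Y ∈ Λ_L^n`. [folklore] -/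
theorem vecCons_mem_boxN_iff {L : ℝ} {x : Space} {Y : Config n} :
    Matrix.vecCons x Y ∈ boxN (n + 1) L ↔ x ∈ box L ∧ Y ∈ boxN n L := by
  simp only [boxN, Set.mem_setOf_eq, Fin.forall_fin_succ, Matrix.cons_val_zero,
    Matrix.cons_val_succ]

/-- The one-particle box has finite volume. [folklore] -/
theorem volume_box_ne_top (L : ℝ) : volume (box L) ≠ ⊤ := by
  rw [volume_box]; exact ENNReal.pow_ne_top ENNReal.ofReal_ne_top

/-- The one-particle box of positive side has positive volume. [folklore] -/
theorem volume_box_pos {L : ℝ} (hL : 0 < L) : 0 < volume (box L) := by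
  rw [volume_box]; exact ENNReal.pow_pos (ENNReal.ofReal_pos.2 hL) 3

/-- A real bound `|r| ≤ K` in `[0, ∞]`: `‖r‖₊ ≤ ofReal K`. [folklore] -/
theorem coe_nnnorm_le_ofReal {r K : ℝ} (h : |r| ≤ K) : (‖r‖₊ : ℝ≥0∞) ≤ ENNReal.ofReal K := by
  have h1 : (‖r‖₊ : ℝ≥0∞) = ENNReal.ofReal ‖r‖ := by rw [ofReal_norm, enorm_eq_nnnorm]
  rw [h1, Real.norm_eq_abs]
  exact ENNReal.ofReal_le_ofReal h

/-- Slices of a measurable real function are measurable. [folklore] -/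
theorem measurable_slice {f : Config (n + 1) → ℝ} (hf : Measurable f) (Y : Config n) :
    Measurable fun x : Space => f (Matrix.vecCons x Y) :=
  hf.comp (measurable_vecCons.comp (measurable_id.prodMk measurable_const))

/-- `Y ↦ ∫ |f(x :: Y)|^p dx` is measurable (Tonelli). [folklore] -/
theorem measurable_lintegral_nnnorm_pow_vecCons {f : Config (n + 1) → ℝ} (hf : Measurable f)
    (p : ℕ) :
    Measurable fun Y : Config n => ∫⁻ x : Space, (‖f (Matrix.vecCons x Y)‖₊ : ℝ≥0∞) ^ p :=
  ((hf.comp measurable_vecCons).nnnorm.coe_nnreal_ennreal.pow_const p).lintegral_prod_left'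

/-- `Y ↦ ∫ |f(x :: Y)| dx` is measurable (Tonelli). [folklore] -/
theorem measurable_lintegral_nnnorm_vecCons {f : Config (n + 1) → ℝ} (hf : Measurable f) :
    Measurable fun Y : Config n => ∫⁻ x : Space, (‖f (Matrix.vecCons x Y)‖₊ : ℝ≥0∞) :=
  (hf.comp measurable_vecCons).nnnorm.coe_nnreal_ennreal.lintegral_prod_left'

/-- The landscape integrand `Y ↦ L³ m(Y)²/s(Y)²` of a measurable real `f` is measurable.
[folklore] -/
theorem measurable_ratioIntegrand {f : Config (n + 1) → ℝ} (hf : Measurable f) (L : ℝ) :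
    Measurable fun Y : Config n => ENNReal.ofReal (L ^ 3) *
      (∫⁻ x, (‖f (Matrix.vecCons x Y)‖₊ : ℝ≥0∞) ^ 2) ^ 2 /
        (∫⁻ x, (‖f (Matrix.vecCons x Y)‖₊ : ℝ≥0∞)) ^ 2 :=
  (((measurable_lintegral_nnnorm_pow_vecCons hf 2).pow_const 2).const_mul _).div
    ((measurable_lintegral_nnnorm_vecCons hf).pow_const 2)

/-- `∫ |g|² ≤ K ∫ |g|` for `|g| ≤ K`. [folklore] -/
theorem lintegral_sq_le_mul_lintegral {g : Space → ℝ} {K : ℝ} (hg : ∀ x, |g x| ≤ K) :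
    ∫⁻ x, (‖g x‖₊ : ℝ≥0∞) ^ 2 ≤ ENNReal.ofReal K * ∫⁻ x, (‖g x‖₊ : ℝ≥0∞) := by
  rw [← lintegral_const_mul' _ _ ENNReal.ofReal_ne_top]
  refine lintegral_mono fun x => ?_
  rw [sq]
  exact mul_le_mul' (coe_nnnorm_le_ofReal (hg x)) le_rfl

/-- `∫ |g| ≤ K |Λ_L|` for `|g| ≤ K` supported in the box. [folklore] -/
theorem lintegral_nnnorm_le_of_bound {L K : ℝ} {g : Space → ℝ} (hg : ∀ x, |g x| ≤ K)
    (hsupp : ∀ x, x ∉ box L → g x = 0) :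
    ∫⁻ x, (‖g x‖₊ : ℝ≥0∞) ≤ ENNReal.ofReal K * volume (box L) := by
  calc ∫⁻ x, (‖g x‖₊ : ℝ≥0∞) ≤ ∫⁻ x, (box L).indicator (fun _ => ENNReal.ofReal K) x := by
        refine lintegral_mono fun x => ?_
        by_cases hx : x ∈ box L
        · rw [Set.indicator_of_mem hx]; exact coe_nnnorm_le_ofReal (hg x)
        · rw [Set.indicator_of_notMem hx, hsupp x hx]; simp
    _ = ENNReal.ofReal K * volume (box L) := by
        rw [lintegral_indicator (measurableSet_box L), setLIntegral_const]

/-- **Dominated convergence of the slice masses**: for measurable `g_i` with `|g_i| ≤ K`,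
supported in `Λ_L`, converging pointwise to `g`, `∫ |g_i|^p → ∫ |g|^p` (`p ≥ 1`). [folklore] -/
theorem tendsto_lintegral_nnnorm_pow_slice {ι : Type*} {l : Filter ι} [l.IsCountablyGenerated]
    {L K : ℝ} {g : ι → Space → ℝ} {g₀ : Space → ℝ} (hgm : ∀ i, Measurable (g i))
    (hbound : ∀ i x, |g i x| ≤ K) (hsupp : ∀ i x, x ∉ box L → g i x = 0)
    (hlim : ∀ x, Tendsto (fun i => g i x) l (𝓝 (g₀ x))) {p : ℕ} (hp : p ≠ 0) :
    Tendsto (fun i => ∫⁻ x, (‖g i x‖₊ : ℝ≥0∞) ^ p) l (𝓝 (∫⁻ x, (‖g₀ x‖₊ : ℝ≥0∞) ^ p)) := by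
  refine tendsto_lintegral_filter_of_dominated_convergence
    ((box L).indicator fun _ => ENNReal.ofReal K ^ p) ?_ ?_ ?_ ?_
  · exact Eventually.of_forall fun i => (hgm i).nnnorm.coe_nnreal_ennreal.pow_const p
  · refine Eventually.of_forall fun i => Eventually.of_forall fun x => ?_
    by_cases hx : x ∈ box L
    · rw [Set.indicator_of_mem hx]
      exact pow_le_pow_left' (coe_nnnorm_le_ofReal (hbound i x)) p
    · rw [Set.indicator_of_notMem hx, hsupp i x hx]
      simp [hp]
  · rw [lintegral_indicator (measurableSet_box L), setLIntegral_const]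
    exact ENNReal.mul_ne_top (ENNReal.pow_ne_top ENNReal.ofReal_ne_top) (volume_box_ne_top L)
  · exact Eventually.of_forall fun x =>
      ENNReal.Tendsto.pow ((ENNReal.continuous_coe.tendsto _).comp (hlim x).nnnorm)

/-! ### The landscape ratio through limits -/

/-- **Fatou for the landscape ratio.** If measurable `f_k : (ℝ³)^{n+1} → ℝ`, `|f_k| ≤ K`,
supported in `Λ_L^{n+1}`, converge pointwise to `f`, then
`∫ L³ m_f²/s_f² dY ≤ liminf_k ∫ L³ m_{f_k}²/s_{f_k}² dY` (dominated convergence in `x` slice by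
slice, lower semicontinuity of `m²/s²` along `m ≤ K s`, Fatou in `Y`). [folklore] -/
theorem lintegral_ratio_le_liminf {L K : ℝ} {f : ℕ → Config (n + 1) → ℝ}
    {f₀ : Config (n + 1) → ℝ} (hfm : ∀ k, Measurable (f k))
    (hbound : ∀ k X, |f k X| ≤ K) (hsupp : ∀ k X, X ∉ boxN (n + 1) L → f k X = 0)
    (hlim : ∀ X, Tendsto (fun k => f k X) atTop (𝓝 (f₀ X))) :
    ∫⁻ Y : Config n, ENNReal.ofReal (L ^ 3) *
        (∫⁻ x, (‖f₀ (Matrix.vecCons x Y)‖₊ : ℝ≥0∞) ^ 2) ^ 2 /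
          (∫⁻ x, (‖f₀ (Matrix.vecCons x Y)‖₊ : ℝ≥0∞)) ^ 2 ≤
      liminf (fun k => ∫⁻ Y : Config n, ENNReal.ofReal (L ^ 3) *
        (∫⁻ x, (‖f k (Matrix.vecCons x Y)‖₊ : ℝ≥0∞) ^ 2) ^ 2 /
          (∫⁻ x, (‖f k (Matrix.vecCons x Y)‖₊ : ℝ≥0∞)) ^ 2) atTop := by
  have hb0 : ∀ X, |f₀ X| ≤ K := fun X =>
    le_of_tendsto ((hlim X).abs) (Eventually.of_forall fun k => hbound k X)
  -- slice by slice
  have hslice : ∀ Y : Config n,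
      Tendsto (fun k => ∫⁻ x, (‖f k (Matrix.vecCons x Y)‖₊ : ℝ≥0∞) ^ 2) atTop
        (𝓝 (∫⁻ x, (‖f₀ (Matrix.vecCons x Y)‖₊ : ℝ≥0∞) ^ 2)) ∧
      Tendsto (fun k => ∫⁻ x, (‖f k (Matrix.vecCons x Y)‖₊ : ℝ≥0∞)) atTop
        (𝓝 (∫⁻ x, (‖f₀ (Matrix.vecCons x Y)‖₊ : ℝ≥0∞))) := by
    intro Y
    have hgm : ∀ k, Measurable fun x : Space => f k (Matrix.vecCons x Y) :=
      fun k => measurable_slice (hfm k) Y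
    have hgb : ∀ k (x : Space), |f k (Matrix.vecCons x Y)| ≤ K := fun k x => hbound k _
    have hgs : ∀ k (x : Space), x ∉ box L → f k (Matrix.vecCons x Y) = 0 :=
      fun k x hx => hsupp k _ fun h => hx (vecCons_mem_boxN_iff.1 h).1
    have hgl : ∀ x : Space, Tendsto (fun k => f k (Matrix.vecCons x Y)) atTop
        (𝓝 (f₀ (Matrix.vecCons x Y))) := fun x => hlim _
    refine ⟨tendsto_lintegral_nnnorm_pow_slice hgm hgb hgs hgl two_ne_zero, ?_⟩
    simpa using tendsto_lintegral_nnnorm_pow_slice hgm hgb hgs hgl one_ne_zero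
  -- pointwise lower semicontinuity
  have hpt : ∀ Y : Config n, ENNReal.ofReal (L ^ 3) *
      (∫⁻ x, (‖f₀ (Matrix.vecCons x Y)‖₊ : ℝ≥0∞) ^ 2) ^ 2 /
        (∫⁻ x, (‖f₀ (Matrix.vecCons x Y)‖₊ : ℝ≥0∞)) ^ 2 ≤
      liminf (fun k => ENNReal.ofReal (L ^ 3) *
        (∫⁻ x, (‖f k (Matrix.vecCons x Y)‖₊ : ℝ≥0∞) ^ 2) ^ 2 /
          (∫⁻ x, (‖f k (Matrix.vecCons x Y)‖₊ : ℝ≥0∞)) ^ 2) atTop := fun Y =>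
    mul_sq_div_sq_le_liminf ENNReal.ofReal_ne_top ENNReal.ofReal_ne_top (hslice Y).1 (hslice Y).2
      (lintegral_sq_le_mul_lintegral fun x => hb0 _)
  have hmeas : ∀ k, Measurable fun Y : Config n => ENNReal.ofReal (L ^ 3) *
      (∫⁻ x, (‖f k (Matrix.vecCons x Y)‖₊ : ℝ≥0∞) ^ 2) ^ 2 /
        (∫⁻ x, (‖f k (Matrix.vecCons x Y)‖₊ : ℝ≥0∞)) ^ 2 :=
    fun k => measurable_ratioIntegrand (hfm k) L
  exact (lintegral_mono hpt).trans (lintegral_liminf_le hmeas)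

/-- **Dominated convergence for the landscape ratio.** If measurable `f_i`, `|f_i| ≤ K`,
supported in `Λ_L^{n+1}`, have integrands `L³ m_{f_i}(Y)²/s_{f_i}(Y)²` converging for a.e. `Y`
to that of `f`, then the ratios converge (domination by `L³ K²` on `Λ_L^n`, zero off it).
[folklore] -/
theorem tendsto_lintegral_ratio {ι : Type*} {l : Filter ι} [l.IsCountablyGenerated] {L K : ℝ}
    {f : ι → Config (n + 1) → ℝ} {f₀ : Config (n + 1) → ℝ} (hfm : ∀ i, Measurable (f i))
    (hbound : ∀ i X, |f i X| ≤ K) (hsupp : ∀ i X, X ∉ boxN (n + 1) L → f i X = 0)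
    (hlimI : ∀ᵐ Y : Config n, Tendsto (fun i => ENNReal.ofReal (L ^ 3) *
        (∫⁻ x, (‖f i (Matrix.vecCons x Y)‖₊ : ℝ≥0∞) ^ 2) ^ 2 /
          (∫⁻ x, (‖f i (Matrix.vecCons x Y)‖₊ : ℝ≥0∞)) ^ 2) l
      (𝓝 (ENNReal.ofReal (L ^ 3) * (∫⁻ x, (‖f₀ (Matrix.vecCons x Y)‖₊ : ℝ≥0∞) ^ 2) ^ 2 /
          (∫⁻ x, (‖f₀ (Matrix.vecCons x Y)‖₊ : ℝ≥0∞)) ^ 2))) :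
    Tendsto (fun i => ∫⁻ Y : Config n, ENNReal.ofReal (L ^ 3) *
        (∫⁻ x, (‖f i (Matrix.vecCons x Y)‖₊ : ℝ≥0∞) ^ 2) ^ 2 /
          (∫⁻ x, (‖f i (Matrix.vecCons x Y)‖₊ : ℝ≥0∞)) ^ 2) l
      (𝓝 (∫⁻ Y : Config n, ENNReal.ofReal (L ^ 3) *
        (∫⁻ x, (‖f₀ (Matrix.vecCons x Y)‖₊ : ℝ≥0∞) ^ 2) ^ 2 /
          (∫⁻ x, (‖f₀ (Matrix.vecCons x Y)‖₊ : ℝ≥0∞)) ^ 2)) := by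
  refine tendsto_lintegral_filter_of_dominated_convergence
    ((boxN n L).indicator fun _ => ENNReal.ofReal (L ^ 3) * ENNReal.ofReal K ^ 2) ?_ ?_ ?_ hlimI
  · exact Eventually.of_forall fun i => measurable_ratioIntegrand (hfm i) L
  · refine Eventually.of_forall fun i => Eventually.of_forall fun Y => ?_
    by_cases hY : Y ∈ boxN n L
    · rw [Set.indicator_of_mem hY]
      exact mul_sq_div_sq_le (lintegral_sq_le_mul_lintegral fun x => hbound i _)
    · rw [Set.indicator_of_notMem hY]
      have h0 : ∀ x : Space, f i (Matrix.vecCons x Y) = 0 :=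
        fun x => hsupp i _ fun h => hY (vecCons_mem_boxN_iff.1 h).2
      simp [h0]
  · rw [lintegral_indicator (measurableSet_boxN n L), setLIntegral_const]
    exact ENNReal.mul_ne_top (ENNReal.mul_ne_top ENNReal.ofReal_ne_top
      (ENNReal.pow_ne_top ENNReal.ofReal_ne_top)) (volume_boxN_lt_top n L).ne

/-- **Convergence of the landscape integrand at a slice of positive mass.** If measurable `f_i`,
`|f_i| ≤ K`, supported in `Λ_L^{n+1}`, converge pointwise to `f`, and the slice `Y` has
`s_f(Y) = ∫ |f(x :: Y)| dx > 0`, then `L³ m_{f_i}(Y)²/s_{f_i}(Y)² → L³ m_f(Y)²/s_f(Y)²`.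
[folklore] -/
theorem tendsto_ratioIntegrand {ι : Type*} {l : Filter ι} [l.IsCountablyGenerated] [l.NeBot]
    {L K : ℝ} {f : ι → Config (n + 1) → ℝ} {f₀ : Config (n + 1) → ℝ}
    (hfm : ∀ i, Measurable (f i)) (hbound : ∀ i X, |f i X| ≤ K)
    (hsupp : ∀ i X, X ∉ boxN (n + 1) L → f i X = 0)
    (hlim : ∀ X, Tendsto (fun i => f i X) l (𝓝 (f₀ X))) {Y : Config n}
    (hpos : 0 < ∫⁻ x, (‖f₀ (Matrix.vecCons x Y)‖₊ : ℝ≥0∞)) :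
    Tendsto (fun i => ENNReal.ofReal (L ^ 3) *
        (∫⁻ x, (‖f i (Matrix.vecCons x Y)‖₊ : ℝ≥0∞) ^ 2) ^ 2 /
          (∫⁻ x, (‖f i (Matrix.vecCons x Y)‖₊ : ℝ≥0∞)) ^ 2) l
      (𝓝 (ENNReal.ofReal (L ^ 3) * (∫⁻ x, (‖f₀ (Matrix.vecCons x Y)‖₊ : ℝ≥0∞) ^ 2) ^ 2 /
          (∫⁻ x, (‖f₀ (Matrix.vecCons x Y)‖₊ : ℝ≥0∞)) ^ 2)) := by
  have hb0 : ∀ X, |f₀ X| ≤ K := fun X =>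
    le_of_tendsto ((hlim X).abs) (Eventually.of_forall fun i => hbound i X)
  have hs0 : ∀ X, X ∉ boxN (n + 1) L → f₀ X = 0 := fun X hX =>
    tendsto_nhds_unique (hlim X) (tendsto_const_nhds.congr fun i => (hsupp i X hX).symm)
  have hgm : ∀ i, Measurable fun x : Space => f i (Matrix.vecCons x Y) :=
    fun i => measurable_slice (hfm i) Y
  have hgb : ∀ i (x : Space), |f i (Matrix.vecCons x Y)| ≤ K := fun i x => hbound i _
  have hgs : ∀ i (x : Space), x ∉ box L → f i (Matrix.vecCons x Y) = 0 :=
    fun i x hx => hsupp i _ fun h => hx (vecCons_mem_boxN_iff.1 h).1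
  have hgl : ∀ x : Space, Tendsto (fun i => f i (Matrix.vecCons x Y)) l
      (𝓝 (f₀ (Matrix.vecCons x Y))) := fun x => hlim _
  have hm := tendsto_lintegral_nnnorm_pow_slice hgm hgb hgs hgl two_ne_zero
  have hs : Tendsto (fun i => ∫⁻ x, (‖f i (Matrix.vecCons x Y)‖₊ : ℝ≥0∞)) l
      (𝓝 (∫⁻ x, (‖f₀ (Matrix.vecCons x Y)‖₊ : ℝ≥0∞))) := by
    simpa using tendsto_lintegral_nnnorm_pow_slice hgm hgb hgs hgl one_ne_zero
  -- finiteness of the limit masses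
  have hsfin : ∫⁻ x, (‖f₀ (Matrix.vecCons x Y)‖₊ : ℝ≥0∞) ≠ ⊤ :=
    ne_top_of_le_ne_top (ENNReal.mul_ne_top ENNReal.ofReal_ne_top (volume_box_ne_top L))
      (lintegral_nnnorm_le_of_bound (fun x => hb0 _)
        (fun x hx => hs0 _ fun h => hx (vecCons_mem_boxN_iff.1 h).1))
  have hmfin : ∫⁻ x, (‖f₀ (Matrix.vecCons x Y)‖₊ : ℝ≥0∞) ^ 2 ≠ ⊤ :=
    ne_top_of_le_ne_top (ENNReal.mul_ne_top ENNReal.ofReal_ne_top hsfin)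
      (lintegral_sq_le_mul_lintegral fun x => hb0 _)
  exact tendsto_mul_sq_div_sq ENNReal.ofReal_ne_top hm hs hmfin hpos.ne' hsfin

/-- **A slice through the open box of a function positive on the box has positive mass**:
if `f > 0` on `Λ_L^{n+1}` (`L > 0`) and `Y ∈ Λ_L^n` then `∫ |f(x :: Y)| dx > 0`. [folklore] -/
theorem lintegral_nnnorm_slice_pos {L : ℝ} (hL : 0 < L) {f : Config (n + 1) → ℝ}
    (hf : Measurable f) (hpos : ∀ X ∈ boxN (n + 1) L, 0 < f X) {Y : Config n}
    (hY : Y ∈ boxN n L) : 0 < ∫⁻ x, (‖f (Matrix.vecCons x Y)‖₊ : ℝ≥0∞) := by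
  rw [lintegral_pos_iff_support (measurable_slice hf Y).nnnorm.coe_nnreal_ennreal]
  have hsub : box L ⊆ Function.support fun x : Space => (‖f (Matrix.vecCons x Y)‖₊ : ℝ≥0∞) := by
    intro x hx
    simp only [Function.mem_support, ne_eq, ENNReal.coe_eq_zero, nnnorm_eq_zero]
    exact (hpos _ (vecCons_mem_boxN_iff.2 ⟨hx, hY⟩)).ne'
  exact (volume_box_pos hL).trans_le (measure_mono hsub)

/-- **Scaling**: `R_L(c f) = c² R_L(f)` for `c ≠ 0` (`m ↦ c² m`, `s ↦ |c| s`). [folklore] -/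
theorem lintegral_ratio_const_mul (L : ℝ) (f : Config (n + 1) → ℝ) {c : ℝ} (hc : c ≠ 0) :
    ∫⁻ Y : Config n, ENNReal.ofReal (L ^ 3) *
        (∫⁻ x, (‖c * f (Matrix.vecCons x Y)‖₊ : ℝ≥0∞) ^ 2) ^ 2 /
          (∫⁻ x, (‖c * f (Matrix.vecCons x Y)‖₊ : ℝ≥0∞)) ^ 2 =
      ENNReal.ofReal (c ^ 2) * ∫⁻ Y : Config n, ENNReal.ofReal (L ^ 3) *
        (∫⁻ x, (‖f (Matrix.vecCons x Y)‖₊ : ℝ≥0∞) ^ 2) ^ 2 /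
          (∫⁻ x, (‖f (Matrix.vecCons x Y)‖₊ : ℝ≥0∞)) ^ 2 := by
  set C : ℝ≥0∞ := (‖c‖₊ : ℝ≥0∞) with hC
  have hC0 : C ≠ 0 := by simp [hC, hc]
  have hCt : C ≠ ⊤ := ENNReal.coe_ne_top
  have hC2 : ENNReal.ofReal (c ^ 2) = C ^ 2 := by
    rw [hC, show c ^ 2 = ‖c‖ ^ 2 by rw [Real.norm_eq_abs, sq_abs], ENNReal.ofReal_pow (norm_nonneg _),
      ofReal_norm, enorm_eq_nnnorm]
  rw [hC2, ← lintegral_const_mul' _ _ (ENNReal.pow_ne_top hCt)]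
  refine lintegral_congr fun Y => ?_
  have hm : ∫⁻ x, (‖c * f (Matrix.vecCons x Y)‖₊ : ℝ≥0∞) ^ 2 =
      C ^ 2 * ∫⁻ x, (‖f (Matrix.vecCons x Y)‖₊ : ℝ≥0∞) ^ 2 := by
    rw [← lintegral_const_mul' _ _ (ENNReal.pow_ne_top hCt)]
    refine lintegral_congr fun x => ?_
    rw [nnnorm_mul, ENNReal.coe_mul, mul_pow]
  have hs : ∫⁻ x, (‖c * f (Matrix.vecCons x Y)‖₊ : ℝ≥0∞) =
      C * ∫⁻ x, (‖f (Matrix.vecCons x Y)‖₊ : ℝ≥0∞) := by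
    rw [← lintegral_const_mul' _ _ hCt]
    refine lintegral_congr fun x => ?_
    rw [nnnorm_mul, ENNReal.coe_mul]
  rw [hm, hs]
  set m := ∫⁻ x, (‖f (Matrix.vecCons x Y)‖₊ : ℝ≥0∞) ^ 2
  set s := ∫⁻ x, (‖f (Matrix.vecCons x Y)‖₊ : ℝ≥0∞)
  have h2 : C ^ 2 ≠ 0 := pow_ne_zero 2 hC0
  have h2t : C ^ 2 ≠ ⊤ := ENNReal.pow_ne_top hCt
  calc ENNReal.ofReal (L ^ 3) * (C ^ 2 * m) ^ 2 / (C * s) ^ 2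
      = ENNReal.ofReal (L ^ 3) * ((C ^ 2 * (C ^ 2 * m ^ 2)) / (C ^ 2 * s ^ 2)) := by
        rw [mul_div_assoc]; congr 1; ring
    _ = ENNReal.ofReal (L ^ 3) * ((C ^ 2 * m ^ 2) / s ^ 2) := by
        rw [ENNReal.mul_div_mul_left _ _ h2 h2t]
    _ = C ^ 2 * (ENNReal.ofReal (L ^ 3) * m ^ 2 / s ^ 2) := by
        rw [mul_div_assoc, mul_div_assoc, mul_left_comm]

end Summit.AtomisticToContinuum.BoseEinsteinCondensation.Theorems.CutLineWitness

end
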